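import Summits.CriticalPhenomena.SAWScalingLimit.Theses.SAWTotalPositivity
import Summits.CriticalPhenomena.SAWScalingLimit.Theorems.SAWTotalPositivityBoundaryTP2Defs
import Summits.CriticalPhenomena.SAWScalingLimit.Theorems.SAWTotalPositivityBoundaryTP2Kernel
import Summits.CriticalPhenomena.SAWScalingLimit.Theorems.SAWTotalPositivityBoundaryTP2Symmetry
import Summits.CriticalPhenomena.SAWScalingLimit.Theorems.SAWTotalPositivityBoundaryTP2RectOnePerSide
import Summits.CriticalPhenomena.SAWScalingLimit.Theorems.SAWTotalPositivityBoundaryTP2RectCornersDisjoint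
import Summits.CriticalPhenomena.SAWScalingLimit.Theorems.SAWTotalPositivityBoundaryTP2RectReflect
import Summits.CriticalPhenomena.SAWScalingLimit.Theorems.SAWTotalPositivityBoundaryTP2LadderKernels
import Summits.CriticalPhenomena.SAWScalingLimit.Theorems.EdgeOfPositivity.Negative.EdgeOfPositivityRectDomain
import Literature.Probability.RandomPlanarGeometry.SelfAvoidingWalkProofs
import HarnessLib

/-!
# Crux `BoundaryTP2` (stmt-CriticalPhenomena-7115): corner TP₂ on EVERY ladder — the first all-sizes family

Line `Sketch`, lead c5.  The crux `BoundaryTP2` (circular TP₂ of the critical SAW boundary kernel) has so far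
been confirmed only instance by instance (certified boxes ≤ 6×5, realised L-shapes and slits, all animals
≤ 11 sites).  This file proves it for an INFINITE family of typed instances at once: the four corners of the
ladder `{0,…,L} × {0,1}` — the discrete domain, at mesh `1`, of the open rectangle `rectDomain L 1` — for
every `L ≥ 1`, in BOTH labellings of the corner cycle, and at every fugacity `0 ≤ x ≤ 1/2` (resp. `≤ 1`),
hence at `x_c ≤ 1/2` (`SAW.criticalFugacity_le_half`).

Ingredients (all landed for this line): the exact corner kernels `stub_ladderKernels`
(`Z((0,r),(L,s)) = x^L((1+x)^{L+1} ± (1-x)^{L+1})/2`), the reflection symmetry `stub_rect_reflect`, and the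
structural hypotheses `stub_rect_onePerSide` (interlacing) and `stub_rect_cornersDisjoint`.  The two
inequalities reduce to `D_L ≤ S_L` (i.e. `(1-x)^{L+1} x^L ≥ 0`, all `x ≤ 1`) and `D_L ≤ x + x³ ≤ Z(rung)`
(for `x(1+x) ≤ 1`, in particular `x ≤ 1/2`; the rung kernel is bounded below by its two shortest paths).
The typed corollaries `ladder_boundaryTP2_sides` / `ladder_boundaryTP2_rungs` state, for `Ω = rectDomain L 1`,
`δ = 1`, that the three hypotheses of `BoundaryTP2` hold AS TYPED and that its conclusion holds.
-/

noncomputable section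

namespace Summit.CriticalPhenomena.SAWScalingLimit.Theorems.BoundaryTP2

open Literature.Probability.LatticeModels Literature.Probability.RandomPlanarGeometry
open Summit.CriticalPhenomena.SAWScalingLimit.Theorems.EdgeOfPositivity.Negative
open scoped ENNReal

/-! ## Real inequalities between the closed forms -/

/-- `D_L ≤ S_L`: the cross-corner kernel is at most the same-row kernel, `0 ≤ x ≤ 1`. [folklore] -/
theorem ladder_diag_le_same {x : ℝ} (hx0 : 0 ≤ x) (hx1 : x ≤ 1) (L : ℕ) :
    x ^ L * ((1 + x) ^ (L + 1) + (-1) * (1 - x) ^ (L + 1)) / 2 ≤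
      x ^ L * ((1 + x) ^ (L + 1) + 1 * (1 - x) ^ (L + 1)) / 2 := by
  have h1 : 0 ≤ (1 - x) ^ (L + 1) := pow_nonneg (by linarith) _
  have h2 : 0 ≤ x ^ L := pow_nonneg hx0 _
  nlinarith [mul_nonneg h2 h1]

/-- `D_L ≤ x + x³` for `L ≥ 1` and `x (1 + x) ≤ 1` (e.g. `x ≤ 1/2`): `D_L ≤ (1+x)(x(1+x))^L/2 ≤ x(1+x)²/2`
and `(1+x)² ≤ 2(1+x²)`. [folklore] -/
theorem ladder_diag_le_rung {x : ℝ} (hx0 : 0 ≤ x) (hx : x * (1 + x) ≤ 1) {L : ℕ} (hL : 1 ≤ L) :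
    x ^ L * ((1 + x) ^ (L + 1) + (-1) * (1 - x) ^ (L + 1)) / 2 ≤ x + x ^ 3 := by
  have h1x : 0 ≤ 1 + x := by linarith
  have hx1 : x ≤ 1 := by nlinarith
  have hq0 : 0 ≤ x * (1 + x) := mul_nonneg hx0 h1x
  have hpow : (x * (1 + x)) ^ L ≤ x * (1 + x) := by
    calc (x * (1 + x)) ^ L ≤ (x * (1 + x)) ^ 1 := pow_le_pow_of_le_one hq0 hx hL
      _ = x * (1 + x) := pow_one _
  have h3 : 0 ≤ (1 - x) ^ (L + 1) := pow_nonneg (by linarith) _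
  have hxL : 0 ≤ x ^ L := pow_nonneg hx0 _
  calc x ^ L * ((1 + x) ^ (L + 1) + (-1) * (1 - x) ^ (L + 1)) / 2
      ≤ x ^ L * (1 + x) ^ (L + 1) / 2 := by
        have := mul_le_mul_of_nonneg_left (show (1 + x) ^ (L + 1) + (-1) * (1 - x) ^ (L + 1) ≤
          (1 + x) ^ (L + 1) by linarith) hxL
        linarith
    _ = (1 + x) / 2 * (x * (1 + x)) ^ L := by rw [mul_pow]; ring
    _ ≤ (1 + x) / 2 * (x * (1 + x)) := mul_le_mul_of_nonneg_left hpow (by linarith)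
    _ ≤ x + x ^ 3 := by nlinarith [sq_nonneg (1 - x)]

/-! ## Kernel facts on the ladder -/

/-- Equality of sites from their two coordinates. [folklore] -/
private theorem st_eq_st_iff {i j i' j' : ℤ} : st i j = st i' j' ↔ i = i' ∧ j = j' := by
  constructor
  · intro h
    exact ⟨by simpa using congrFun h 0, by simpa using congrFun h 1⟩
  · rintro ⟨rfl, rfl⟩; rfl

/-- Adjacency in the ladder `{0..L}×{0,1}` between explicitly given in-box lattice neighbours. [folklore] -/
private theorem ladder_adj_of {L : ℕ} {i j i' j' : ℤ} (hzd : (zdGraph 2).Adj (st i j) (st i' j'))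
    (hi : 0 ≤ i ∧ i ≤ L) (hj : 0 ≤ j ∧ j ≤ 1) (hi' : 0 ≤ i' ∧ i' ≤ L) (hj' : 0 ≤ j' ∧ j' ≤ 1) :
    (discreteDomainGraph (rectDomain L 1) 1).Adj (st i j) (st i' j') := by
  rw [adj_rect_iff]
  refine ⟨hzd, ?_, ?_⟩ <;> simp only [mem_rectSites_iff, st_zero, st_one, Nat.cast_one] <;> omega

/-- **Lower bound for the rung.** For `L ≥ 1` the kernel between the two left corners is at least
`x + x³`: the rung itself and the detour around the first unit square are two distinct self-avoiding paths.
[folklore] -/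
theorem ladder_rung_ge (L : ℕ) (hL : 1 ≤ L) {x : ℝ} (hx : 0 ≤ x) :
    ENNReal.ofReal (x + x ^ 3) ≤ pathKernel (discreteDomainGraph (rectDomain L 1) 1) x (st 0 1) (st 0 0) := by
  classical
  set R := discreteDomainGraph (rectDomain L 1) 1 with hR
  have hL' : (1 : ℤ) ≤ (L : ℤ) := by exact_mod_cast hL
  -- the four edges used
  have e10 : R.Adj (st 0 1) (st 0 0) :=
    ladder_adj_of (by simpa using (zdGraph_adj_st_succ_right 0 0).symm) ⟨le_rfl, by omega⟩
      ⟨by omega, le_rfl⟩ ⟨le_rfl, by omega⟩ ⟨le_rfl, by omega⟩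
  have e1 : R.Adj (st 0 1) (st 1 1) :=
    ladder_adj_of (by simpa using zdGraph_adj_st_succ_left 0 1) ⟨le_rfl, by omega⟩ ⟨by omega, le_rfl⟩
      ⟨by omega, hL'⟩ ⟨by omega, le_rfl⟩
  have e2 : R.Adj (st 1 1) (st 1 0) :=
    ladder_adj_of (by simpa using (zdGraph_adj_st_succ_right 1 0).symm) ⟨by omega, hL'⟩ ⟨by omega, le_rfl⟩
      ⟨by omega, hL'⟩ ⟨le_rfl, by omega⟩
  have e3 : R.Adj (st 1 0) (st 0 0) :=
    ladder_adj_of (by simpa using (zdGraph_adj_st_succ_left 0 0).symm) ⟨by omega, hL'⟩ ⟨le_rfl, by omega⟩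
      ⟨le_rfl, by omega⟩ ⟨le_rfl, by omega⟩
  -- the two paths
  let w₁ : R.Walk (st 0 1) (st 0 0) := SimpleGraph.Walk.cons e10 SimpleGraph.Walk.nil
  let w₂ : R.Walk (st 0 1) (st 0 0) :=
    SimpleGraph.Walk.cons e1 (SimpleGraph.Walk.cons e2 (SimpleGraph.Walk.cons e3 SimpleGraph.Walk.nil))
  have hw₁ : w₁.IsPath :=
    (SimpleGraph.Walk.cons_isPath_iff _ _).2 ⟨SimpleGraph.Walk.IsPath.nil, by
      simp [st_eq_st_iff]⟩
  have hp3 : (SimpleGraph.Walk.cons e3 SimpleGraph.Walk.nil : R.Walk (st 1 0) (st 0 0)).IsPath :=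
    (SimpleGraph.Walk.cons_isPath_iff _ _).2 ⟨SimpleGraph.Walk.IsPath.nil, by simp [st_eq_st_iff]⟩
  have hp2 : (SimpleGraph.Walk.cons e2 (SimpleGraph.Walk.cons e3 SimpleGraph.Walk.nil) :
      R.Walk (st 1 1) (st 0 0)).IsPath :=
    (SimpleGraph.Walk.cons_isPath_iff _ _).2 ⟨hp3, by simp [st_eq_st_iff]⟩
  have hw₂ : w₂.IsPath :=
    (SimpleGraph.Walk.cons_isPath_iff _ _).2 ⟨hp2, by simp [st_eq_st_iff]⟩
  let γ₁ : R.Path (st 0 1) (st 0 0) := ⟨w₁, hw₁⟩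
  let γ₂ : R.Path (st 0 1) (st 0 0) := ⟨w₂, hw₂⟩
  have hne : γ₁ ≠ γ₂ := by
    intro h
    have := congrArg (fun γ : R.Path (st 0 1) (st 0 0) => γ.1.length) h
    simp [γ₁, γ₂, w₁, w₂] at this
  have hlen₁ : γ₁.1.length = 1 := rfl
  have hlen₂ : γ₂.1.length = 3 := rfl
  calc ENNReal.ofReal (x + x ^ 3)
      = ENNReal.ofReal (x ^ γ₁.1.length) + ENNReal.ofReal (x ^ γ₂.1.length) := by
        rw [hlen₁, hlen₂, pow_one, ENNReal.ofReal_add hx (pow_nonneg hx 3)]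
    _ = ∑ γ ∈ ({γ₁, γ₂} : Finset (R.Path (st 0 1) (st 0 0))), ENNReal.ofReal (x ^ γ.1.length) :=
        (Finset.sum_pair (f := fun γ : R.Path (st 0 1) (st 0 0) => ENNReal.ofReal (x ^ γ.1.length)) hne).symm
    _ ≤ pathKernel R x (st 0 1) (st 0 0) := ENNReal.sum_le_tsum _

/-! ## Corner TP₂ on every ladder (graph level) -/

/-- **Diagonals against the two long sides** (labelling `(p₁,p₄,p₃,p₂) = ((0,1),(L,1),(L,0),(0,0))`): for every
`L` and every `0 ≤ x ≤ 1`, `Z((0,1),(L,0))·Z((L,1),(0,0)) ≤ Z((0,1),(L,1))·Z((L,0),(0,0))`, i.e. `D_L² ≤ S_L²`.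
[folklore] -/
theorem ladder_tp2_sides (L : ℕ) {x : ℝ} (hx0 : 0 ≤ x) (hx1 : x ≤ 1) :
    pathKernel (discreteDomainGraph (rectDomain L 1) 1) x (st 0 1) (st L 0) *
        pathKernel (discreteDomainGraph (rectDomain L 1) 1) x (st L 1) (st 0 0) ≤
      pathKernel (discreteDomainGraph (rectDomain L 1) 1) x (st 0 1) (st L 1) *
        pathKernel (discreteDomainGraph (rectDomain L 1) 1) x (st L 0) (st 0 0) := by
  rw [pathKernel_comm _ x (st L 1) (st 0 0), pathKernel_comm _ x (st L 0) (st 0 0),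
    stub_ladderKernels L hx0 1 0 (Or.inr rfl) (Or.inl rfl), stub_ladderKernels L hx0 0 1 (Or.inl rfl) (Or.inr rfl),
    stub_ladderKernels L hx0 1 1 (Or.inr rfl) (Or.inr rfl), stub_ladderKernels L hx0 0 0 (Or.inl rfl) (Or.inl rfl)]
  simp only [one_ne_zero, zero_ne_one, if_false, if_true]
  have h := ENNReal.ofReal_le_ofReal (ladder_diag_le_same hx0 hx1 L)
  exact mul_le_mul' h h

/-- **Diagonals against the two rungs** (labelling `(p₁,p₂,p₃,p₄) = ((0,1),(0,0),(L,0),(L,1))`): for every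
`L ≥ 1` and every `0 ≤ x` with `x(1+x) ≤ 1` (in particular `x ≤ 1/2`),
`Z((0,1),(L,0))·Z((0,0),(L,1)) ≤ Z((0,1),(0,0))·Z((L,0),(L,1))`. [folklore] -/
theorem ladder_tp2_rungs (L : ℕ) (hL : 1 ≤ L) {x : ℝ} (hx0 : 0 ≤ x) (hx : x * (1 + x) ≤ 1) :
    pathKernel (discreteDomainGraph (rectDomain L 1) 1) x (st 0 1) (st L 0) *
        pathKernel (discreteDomainGraph (rectDomain L 1) 1) x (st 0 0) (st L 1) ≤
      pathKernel (discreteDomainGraph (rectDomain L 1) 1) x (st 0 1) (st 0 0) *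
        pathKernel (discreteDomainGraph (rectDomain L 1) 1) x (st L 0) (st L 1) := by
  -- the right rung equals the left rung by the reflection `i ↦ L - i`
  have hrefl : pathKernel (discreteDomainGraph (rectDomain L 1) 1) x (st L 0) (st L 1) =
      pathKernel (discreteDomainGraph (rectDomain L 1) 1) x (st 0 1) (st 0 0) := by
    rw [(stub_rect_reflect L 1 x L 0 L 1).1, sub_self, pathKernel_comm]
  rw [hrefl, stub_ladderKernels L hx0 1 0 (Or.inr rfl) (Or.inl rfl),
    stub_ladderKernels L hx0 0 1 (Or.inl rfl) (Or.inr rfl)]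
  simp only [one_ne_zero, zero_ne_one, if_false]
  have h := (ENNReal.ofReal_le_ofReal (ladder_diag_le_rung hx0 hx hL)).trans (ladder_rung_ge L hL hx0)
  exact mul_le_mul' h h

/-! ## The typed instances of the crux -/

/-- `x_c (1 + x_c) ≤ 1`, from `0 < x_c ≤ 1/2`. [folklore] -/
private theorem criticalFugacity_mul_le : SAW.criticalFugacity * (1 + SAW.criticalFugacity) ≤ 1 := by
  have h0 := SAW.criticalFugacity_pos_lt_one'.1
  have h2 := SAW.criticalFugacity_le_half
  nlinarith

/-- **`BoundaryTP2` on every ladder, rung labelling.** For `Ω = rectDomain L 1` (`L ≥ 1`), `δ = 1` and the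
corners `p₁ = (0,1)`, `p₂ = (0,0)`, `p₃ = (L,0)`, `p₄ = (L,1)`, the three hypotheses of the crux hold as typed
(interlacing; `(p₁p₂|p₃p₄)` and `(p₁p₄|p₂p₃)` disjointly realisable) AND its conclusion holds:
`Z(p₁,p₃) Z(p₂,p₄) ≤ Z(p₁,p₂) Z(p₃,p₄)`. [folklore] -/
theorem ladder_boundaryTP2_rungs (L : ℕ) (hL : 1 ≤ L) :
    (∀ (P : SAW.DomainSAW (rectDomain L 1) 1 (st 0 1) (st L 0))
        (Q : SAW.DomainSAW (rectDomain L 1) 1 (st 0 0) (st L 1)),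
        ∃ v, v ∈ P.walk.support ∧ v ∈ Q.walk.support) ∧
    (∃ (P : SAW.DomainSAW (rectDomain L 1) 1 (st 0 1) (st 0 0))
        (Q : SAW.DomainSAW (rectDomain L 1) 1 (st L 0) (st L 1)),
        List.Disjoint P.walk.support Q.walk.support) ∧
    (∃ (P : SAW.DomainSAW (rectDomain L 1) 1 (st 0 1) (st L 1))
        (Q : SAW.DomainSAW (rectDomain L 1) 1 (st 0 0) (st L 0)),
        List.Disjoint P.walk.support Q.walk.support) ∧
    SAW.weight (rectDomain L 1) 1 (st 0 1) (st L 0) Set.univ *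
        SAW.weight (rectDomain L 1) 1 (st 0 0) (st L 1) Set.univ ≤
      SAW.weight (rectDomain L 1) 1 (st 0 1) (st 0 0) Set.univ *
        SAW.weight (rectDomain L 1) 1 (st L 0) (st L 1) Set.univ := by
  have hI : Interlaced (discreteDomainGraph (rectDomain L 1) 1) (st 0 1) (st 0 0) (st L 0) (st L 1) :=
    stub_rect_onePerSide L 1 (by simp [mem_rectSites_iff]) (by simp [mem_rectSites_iff])
      (by simp [mem_rectSites_iff]) (by simp [mem_rectSites_iff]) rfl rfl rfl (by simp)
  obtain ⟨hD₁, hD₂⟩ := stub_rect_cornersDisjoint L 1 hL le_rfl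
  refine ⟨fun P Q => hI ⟨P.walk, P.isPath⟩ ⟨Q.walk, Q.isPath⟩, ?_, ?_, ?_⟩
  · obtain ⟨P, Q, hPQ⟩ := hD₁
    exact ⟨⟨P.1, P.2⟩, ⟨Q.1, Q.2⟩, by simpa using hPQ⟩
  · obtain ⟨P, Q, hPQ⟩ := hD₂
    exact ⟨⟨P.1, P.2⟩, ⟨Q.1, Q.2⟩, by simpa using hPQ⟩
  · simp only [weight_univ_eq_pathKernel]
    exact ladder_tp2_rungs L hL SAW.criticalFugacity_pos_lt_one'.1.le criticalFugacity_mul_le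

/-- **`BoundaryTP2` on every ladder, side labelling.** For `Ω = rectDomain L 1` (`L ≥ 1`), `δ = 1` and the
corners relabelled `p₁ = (0,1)`, `p₂ = (L,1)`, `p₃ = (L,0)`, `p₄ = (0,0)`, the three hypotheses of the crux
hold as typed AND its conclusion holds: `Z(p₁,p₃) Z(p₂,p₄) ≤ Z(p₁,p₂) Z(p₃,p₄)` (diagonals against the two
long sides). [folklore] -/
theorem ladder_boundaryTP2_sides (L : ℕ) (hL : 1 ≤ L) :
    (∀ (P : SAW.DomainSAW (rectDomain L 1) 1 (st 0 1) (st L 0))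
        (Q : SAW.DomainSAW (rectDomain L 1) 1 (st L 1) (st 0 0)),
        ∃ v, v ∈ P.walk.support ∧ v ∈ Q.walk.support) ∧
    (∃ (P : SAW.DomainSAW (rectDomain L 1) 1 (st 0 1) (st L 1))
        (Q : SAW.DomainSAW (rectDomain L 1) 1 (st L 0) (st 0 0)),
        List.Disjoint P.walk.support Q.walk.support) ∧
    (∃ (P : SAW.DomainSAW (rectDomain L 1) 1 (st 0 1) (st 0 0))
        (Q : SAW.DomainSAW (rectDomain L 1) 1 (st L 1) (st L 0)),
        List.Disjoint P.walk.support Q.walk.support) ∧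
    SAW.weight (rectDomain L 1) 1 (st 0 1) (st L 0) Set.univ *
        SAW.weight (rectDomain L 1) 1 (st L 1) (st 0 0) Set.univ ≤
      SAW.weight (rectDomain L 1) 1 (st 0 1) (st L 1) Set.univ *
        SAW.weight (rectDomain L 1) 1 (st L 0) (st 0 0) Set.univ := by
  have hI : Interlaced (discreteDomainGraph (rectDomain L 1) 1) (st 0 1) (st 0 0) (st L 0) (st L 1) :=
    stub_rect_onePerSide L 1 (by simp [mem_rectSites_iff]) (by simp [mem_rectSites_iff])
      (by simp [mem_rectSites_iff]) (by simp [mem_rectSites_iff]) rfl rfl rfl (by simp)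
  have hI' := hI.reverse_right
  obtain ⟨hD₁, hD₂⟩ := stub_rect_cornersDisjoint L 1 hL le_rfl
  refine ⟨fun P Q => hI' ⟨P.walk, P.isPath⟩ ⟨Q.walk, Q.isPath⟩, ?_, ?_, ?_⟩
  · obtain ⟨P, Q, hPQ⟩ := hD₂.reverse_right
    exact ⟨⟨P.1, P.2⟩, ⟨Q.1, Q.2⟩, by simpa using hPQ⟩
  · obtain ⟨P, Q, hPQ⟩ := hD₁.reverse_right
    exact ⟨⟨P.1, P.2⟩, ⟨Q.1, Q.2⟩, by simpa using hPQ⟩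
  · simp only [weight_univ_eq_pathKernel]
    exact ladder_tp2_sides L SAW.criticalFugacity_pos_lt_one'.1.le
      (SAW.criticalFugacity_le_half.trans (by norm_num))

end Summit.CriticalPhenomena.SAWScalingLimit.Theorems.BoundaryTP2
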